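import Summits.QuantumFields.BalabanUV.T4Continuum.Support.NE7K1LinTorusJensen

/-!
# NE7K1LinTorusFloor — row NE7 (node U5), candidate route HOM, path H1L, cell K1-lin(s): (K2)♯ ON THE DOUBLED TORUS —
# `n²(−Δ^𝕋_coarse) ⪯ Schur(H_B^𝕋) ⪯ T^𝕋(s)` and B-E1's REAL-TORUS FLOOR `σ_NN(p) ≤ σ_s(p)`
# (NEEDS-ESTIMATE #E1, B-E1's clause (c′), lower half of the window)

Lineage `b2b-balaban-t4-ne7-p2` (CRUX PROVER NE7 #2), generation 73; file 40.  File 39 (`NE7K1LinTorusJensen`) proved the torus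
Jensen count with constant ONE and the Dirichlet form of the periodic operator; file 38 (`NE7K1LinTorusSymbolReal`) the port «form
order ⇒ symbol order».  THIS FILE assembles the torus twin of `NE7K1LinTwoRunJensen.runA_form_le_schurB_sharp` and B-E1's floor:

* §1 **`torOpK_form_le_torB_form`**: `⟨V, n²(−Δ^𝕋_c)V⟩ ≤ ⟨(V,ψ), H_B^𝕋(V,ψ)⟩` for EVERY chart vector (`a = 0`) — torus Jensen +
  the equal normalisations `n²` vs `L^{−(d+1)}(nL)²`; hence **`torOpK_form_le_schurC_torB`** (`⪯` the hard Schur complement,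
  attained at the KKT fluctuation, `schur_form_eq_min`) and **`torOpK_form_le_torLine`** (`⪯ T^𝕋(s)` for every `s ≥ 0`); on
  representatives (`forms_transport`) **`torOpK_form_le_torLineRep`**.
* §2 THE SYMBOL FLOOR: the periodic operator is translation-invariant entrywise (`torOpK_zero_transl_apply`), its symbol is
  **`symbT_torOpK_zero`** ∕ **`symbT_torOpK_zero_re`** `= n²·Σ_μ (2 − 2cos(2πp_μ∕2N_μ)) =: σ_NN(p)`, and by file 38's port
  **`torSymb_re_ge_nn`**: `σ_NN(p) ≤ σ_s(p)` for every `s ≥ 0`, every mesh `n`, every `L`, every torus `M`, every dual index `p`.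

HONEST FRAMING: [folklore] (finite linear algebra + finite Fourier analysis); `a = 0`; constant ONE as on boxes; no estimate of
Bałaban's; no `sorry`.  Census only (B-E1's clause (c′), lower half, on the finite doubled torus of every size); NE7 NOT PRINTED ∕
NOT PROVED; spine 0∕9; FIXED FINITE T⁴, rung (B)+1; NOT infinite volume, NOT mass gap, NOT Clay.  HONEST DEPENDENCY: continuum YM
on T⁴ ⇐ BetaPertH ∧ nine spine estimates (0/9 proved); BetaPertH ⇐ (D1) ∧ (D4) ∧ CAP+tail; G-an2-4 gates asym, D1 and NE2/3/4.
-/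

noncomputable section

open Finset Matrix Complex

namespace Summit.QuantumFields.BalabanUV.T4Continuum.NE7K1LinTorusFloor

open Literature.MathematicalPhysics.QuantumFieldTheory.Balaban1983to89
open Literature.MathematicalPhysics.QuantumFieldTheory.Balaban1983to89.B4Reflection242
open Literature.MathematicalPhysics.QuantumFieldTheory.Balaban1983to89.B4BoxCov237 (uvec)
open Literature.MathematicalPhysics.QuantumFieldTheory.Balaban1983to89.B4Lower18
open Literature.MathematicalPhysics.QuantumFieldTheory.Balaban1983to89.B4TorusPositivity (wrap wrap_wrap_add)
open NE7K1LinFoldKernels NE7K1LinFoldMatrices NE7K1LinSchurFold NE7K1LinTorusChart NE7K1LinSchurFoldBox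
  NE7K1LinTorusLineInvariant NE7K1LinTorusLineSymbol NE7K1LinTorusSymbolReal NE7K1LinTorusJensen NE7K1LinBlockCoords
  NE7K1LinSchurLineU1 NE7K1LinSchurLineForm NE7K1LinTwoRunKit

variable {d : ℕ}

/-! ### §1 The forms: `n²(−Δ^𝕋_c) ⪯ H_B^𝕋` on every chart vector, hence `⪯ Schur(H_B^𝕋) ⪯ T^𝕋(s)` -/

section Forms

variable {n L : ℕ} [NeZero L] {K Nf : Fin (d + 1) → ℕ} {T : Finset (Fin (d + 1) → ℤ)}

/-- **`⟨V, n²(−Δ^𝕋_c)V⟩ ≤ ⟨(V,ψ), H_B^𝕋(V,ψ)⟩` FOR EVERY CHART VECTOR** (`a = 0`): run A's periodic Dirichlet form at the block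
means is below run B's periodic form in the chart — torus Jensen + the equal normalisations `n²` vs `L^{−(d+1)}(nL)²`. [folklore] -/
theorem torOpK_form_le_torB_form (hK : ∀ i, 1 ≤ K i) (hNf : Nf = fun i => L * K i) (hT : T = boxDom (dbl Nf))
    (hTL : IsBlockUnion L T) (u : ↥(T.image (blk L)) ⊕ (↥(T.image (blk L)) × NZ d L) → ℝ) :
    (fun b => u (Sum.inl b)) ⬝ᵥ torOpK n 0 K (T.image (blk L)) *ᵥ (fun b => u (Sum.inl b)) ≤
      u ⬝ᵥ torB hTL n 0 Nf *ᵥ u := by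
  subst hNf hT
  have hL : 1 ≤ L := NeZero.one_le
  have hLpos : (0 : ℝ) < L := by exact_mod_cast hL
  have hLpow : (0 : ℝ) < (L : ℝ) ^ (d + 1) := pow_pos hLpos _
  have hNf' : ∀ i, 1 ≤ (fun i => L * K i) i := mul_pos_side hL hK
  set φ := coordT hTL *ᵥ u with hφdef
  set V : ↥((boxDom (dbl fun i => L * K i)).image (blk L)) → ℝ := fun b => u (Sum.inl b) with hVdef
  have hφ : ∀ b, ∑ x ∈ Finset.univ.filter (fun x => rblk L _ x = b), φ x = (L : ℝ) ^ (d + 1) * V b :=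
    fun b => blockSum_coordT hTL u b
  -- the two forms, direction by direction
  rw [torB, form_chartOp, torOpK_zero_form n hK (image_blk_dbl hL K) V,
    torOpK_zero_form (n * L) hNf' rfl φ]
  -- Jensen per direction, summed
  have hJ := fun μ => jensen_dir hK φ V hφ μ
  have hsum : (L : ℝ) ^ (d + 1) * ∑ μ : Fin (d + 1), ∑ b : ↥((boxDom (dbl fun i => L * K i)).image (blk L)),
      (V ⟨wrap (dbl K) (b.1 + uvec μ), wrap_mem_labels hK _⟩ - V b) ^ 2 ≤
        (L : ℝ) ^ 2 * ∑ μ : Fin (d + 1), ∑ x : ↥(boxDom (dbl fun i => L * K i)),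
          (φ ⟨wrap (dbl fun i => L * K i) (x.1 + uvec μ), wrap_mem_boxDom (fine_pos hK) _⟩ - φ x) ^ 2 := by
    rw [Finset.mul_sum, Finset.mul_sum]
    exact Finset.sum_le_sum fun μ _ => hJ μ
  have hn2 : (0 : ℝ) ≤ (n : ℝ) ^ 2 := sq_nonneg _
  -- `n²·C ≤ n²·L^{2−(d+1)}·F = (L^{d+1})⁻¹·(nL)²·F`
  have key : (n : ℝ) ^ 2 * ∑ μ : Fin (d + 1), ∑ b : ↥((boxDom (dbl fun i => L * K i)).image (blk L)),
      (V ⟨wrap (dbl K) (b.1 + uvec μ), wrap_mem_labels hK _⟩ - V b) ^ 2 ≤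
        ((L : ℝ) ^ (d + 1))⁻¹ * (((n * L : ℕ) : ℝ) ^ 2 * ∑ μ : Fin (d + 1), ∑ x : ↥(boxDom (dbl fun i => L * K i)),
          (φ ⟨wrap (dbl fun i => L * K i) (x.1 + uvec μ), wrap_mem_boxDom (fine_pos hK) _⟩ - φ x) ^ 2) := by
    refine le_of_mul_le_mul_left ?_ hLpow
    rw [← mul_assoc ((L : ℝ) ^ (d + 1)) (((L : ℝ) ^ (d + 1))⁻¹), mul_inv_cancel₀ hLpow.ne', one_mul]
    have h1 := mul_le_mul_of_nonneg_left hsum hn2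
    push_cast
    calc (L : ℝ) ^ (d + 1) * ((n : ℝ) ^ 2 * ∑ μ : Fin (d + 1), ∑ b : ↥((boxDom (dbl fun i => L * K i)).image (blk L)),
          (V ⟨wrap (dbl K) (b.1 + uvec μ), wrap_mem_labels hK _⟩ - V b) ^ 2)
        = (n : ℝ) ^ 2 * ((L : ℝ) ^ (d + 1) * ∑ μ : Fin (d + 1), ∑ b : ↥((boxDom (dbl fun i => L * K i)).image (blk L)),
          (V ⟨wrap (dbl K) (b.1 + uvec μ), wrap_mem_labels hK _⟩ - V b) ^ 2) := by ring
      _ ≤ (n : ℝ) ^ 2 * ((L : ℝ) ^ 2 * ∑ μ : Fin (d + 1), ∑ x : ↥(boxDom (dbl fun i => L * K i)),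
          (φ ⟨wrap (dbl fun i => L * K i) (x.1 + uvec μ), wrap_mem_boxDom (fine_pos hK) _⟩ - φ x) ^ 2) := h1
      _ = ((n : ℝ) * L) ^ 2 * ∑ μ : Fin (d + 1), ∑ x : ↥(boxDom (dbl fun i => L * K i)),
          (φ ⟨wrap (dbl fun i => L * K i) (x.1 + uvec μ), wrap_mem_boxDom (fine_pos hK) _⟩ - φ x) ^ 2 := by ring
  convert key using 3

/-- **(K2)♯ ON THE TORUS, LOWER HALF: `n²(−Δ^𝕋_c) ⪯ Schur(H_B^𝕋)`** — `⟨V, torOpK n 0 K V⟩ ≤ ⟨V, schurC(torB) V⟩` for every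
`V` (`a = 0`; constant ONE): the Schur form is attained at the KKT fluctuation (`schur_form_eq_min`). [folklore] -/
theorem torOpK_form_le_schurC_torB (hn : 1 ≤ n) (hK : ∀ i, 1 ≤ K i) (hNf : Nf = fun i => L * K i)
    (hT : T = boxDom (dbl Nf)) (hT' : IsBlockUnion (n * L) T) (V : ↥(T.image (blk L)) → ℝ) :
    V ⬝ᵥ torOpK n 0 K (T.image (blk L)) *ᵥ V ≤ V ⬝ᵥ schurC (torB (isBlockUnion_fine hT') n 0 Nf) *ᵥ V := by
  have hNf' : ∀ i, 1 ≤ Nf i := by subst hNf; exact mul_pos_side (NeZero.one_le : 1 ≤ L) hK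
  set H := torB (isBlockUnion_fine hT') n 0 Nf with hH
  have hsymm : H.IsSymm := torB_isSymm (isBlockUnion_fine hT') hT n 0
  have hblocks := (Matrix.isSymm_fromBlocks_iff.1 (by rw [fromBlocks_toBlocks H]; exact hsymm))
  have hDu : IsUnit (H.toBlocks₂₂).det := isUnit_det_torB_fluct hn hT' hT hNf' le_rfl
  set ψ : ↥(T.image (blk L)) × NZ d L → ℝ := -((H.toBlocks₂₂)⁻¹ *ᵥ ((H.toBlocks₂₁) *ᵥ V)) with hψ
  have hmin : V ⬝ᵥ schurC H *ᵥ V = Sum.elim V ψ ⬝ᵥ H *ᵥ (Sum.elim V ψ) := by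
    have h := schur_form_eq_min H.toBlocks₁₁ H.toBlocks₁₂ H.toBlocks₂₁ H.toBlocks₂₂ hblocks.2.1 hblocks.2.2.2 hDu V
    rw [fromBlocks_toBlocks] at h
    exact h
  rw [hmin]
  have h := torOpK_form_le_torB_form (n := n) hK hNf hT (isBlockUnion_fine hT') (Sum.elim V ψ)
  simp only [Sum.elim_inl] at h
  exact h

/-- **`n²(−Δ^𝕋_c) ⪯ T^𝕋(s)` for every `s ≥ 0`** (`a = 0`): `T^𝕋(s) − n²(−Δ^𝕋_c) = s·(Schur(H_B^𝕋) − n²(−Δ^𝕋_c)) ⪰ 0`.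
[folklore] -/
theorem torOpK_form_le_torLine (hn : 1 ≤ n) (hK : ∀ i, 1 ≤ K i) (hNf : Nf = fun i => L * K i)
    (hT : T = boxDom (dbl Nf)) (hT' : IsBlockUnion (n * L) T) {s : ℝ} (hs0 : 0 ≤ s)
    (V : ↥(T.image (blk L)) → ℝ) :
    V ⬝ᵥ torOpK n 0 K (T.image (blk L)) *ᵥ V ≤ V ⬝ᵥ torLine (isBlockUnion_fine hT') n 0 Nf K s *ᵥ V := by
  have h1 := torOpK_form_le_schurC_torB hn hK hNf hT hT' V
  unfold torLine
  rw [lineOpR_eq_schurC, add_mulVec, smul_mulVec, smul_mulVec, dotProduct_add, dotProduct_smul,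
    dotProduct_smul, smul_eq_mul, smul_eq_mul]
  nlinarith [mul_le_mul_of_nonneg_left h1 hs0]

variable {M : Fin (d + 1) → ℕ}

/-- labels of the fine torus `boxDom (dbl (nL·M))` are the representatives `boxDom (dbl (n·M))`, as an equivalence. [folklore] -/
theorem mem_image_of_mem_dbl {x : Fin (d + 1) → ℤ} (hx : x ∈ boxDom (dbl fun i => n * M i)) :
    x ∈ (boxDom (dbl fun i => n * L * M i)).image (blk L) := by
  rw [image_fineTor (NeZero.one_le : 1 ≤ L) n M]; exact hx

/-- and conversely. [folklore] -/
theorem mem_dbl_of_mem_image {x : Fin (d + 1) → ℤ} (hx : x ∈ (boxDom (dbl fun i => n * L * M i)).image (blk L)) :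
    x ∈ boxDom (dbl fun i => n * M i) := by
  rw [image_fineTor (NeZero.one_le : 1 ≤ L) n M] at hx; exact hx

/-- **TRANSPORT OF FORMS TO REPRESENTATIVES**: every `φ` on `boxDom (dbl (n·M))` is a `V` on the label set of the fine torus
with the same periodic Dirichlet form and the same line form (the two index sets coincide, `image_fineTor`). [folklore] -/
theorem forms_transport (hn : 1 ≤ n) (s : ℝ) (φ : ↥(boxDom (dbl fun i => n * M i)) → ℝ) :
    ∃ V : ↥((boxDom (dbl fun i => n * L * M i)).image (blk L)) → ℝ,
      φ ⬝ᵥ torOpK n 0 (fun i => n * M i) (boxDom (dbl fun i => n * M i)) *ᵥ φ =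
          V ⬝ᵥ torOpK n 0 (fun i => n * M i) ((boxDom (dbl fun i => n * L * M i)).image (blk L)) *ᵥ V ∧
        φ ⬝ᵥ torLineRep (L := L) hn M s *ᵥ φ =
          V ⬝ᵥ torLine (isBlockUnion_fine (fineTor_isBlockUnion hn (NeZero.one_le : 1 ≤ L) M)) n 0
            (fun i => n * L * M i) (fun i => n * M i) s *ᵥ V := by
  classical
  have hL : 1 ≤ L := NeZero.one_le
  -- transport along the identification of the label set with the representatives
  set e : ↥(boxDom (dbl fun i => n * M i)) ≃ ↥((boxDom (dbl fun i => n * L * M i)).image (blk L)) :=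
    { toFun := fun x => ⟨x.1, mem_image_of_mem_dbl (L := L) x.2⟩
      invFun := fun y => ⟨y.1, mem_dbl_of_mem_image (L := L) y.2⟩
      left_inv := fun x => Subtype.ext rfl
      right_inv := fun y => Subtype.ext rfl } with he
  refine ⟨fun y => φ (e.symm y), ?_, ?_⟩
  -- both sides are the transported sums
  · have hsum : ∀ (X : Matrix ↥((boxDom (dbl fun i => n * L * M i)).image (blk L))
        ↥((boxDom (dbl fun i => n * L * M i)).image (blk L)) ℝ),
        (fun y => φ (e.symm y)) ⬝ᵥ X *ᵥ (fun y => φ (e.symm y)) = φ ⬝ᵥ (fun x y => X (e x) (e y)) *ᵥ φ := by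
      intro X
      simp only [dotProduct, mulVec]
      rw [← Fintype.sum_equiv e (fun x => φ (e.symm (e x)) * ∑ y, X (e x) y * φ (e.symm y)) _ (fun x => rfl)]
      refine Finset.sum_congr rfl fun x _ => ?_
      rw [Equiv.symm_apply_apply]
      congr 1
      rw [← Fintype.sum_equiv e (fun y => X (e x) (e y) * φ (e.symm (e y))) _ (fun y => rfl)]
      exact Finset.sum_congr rfl fun y _ => by rw [Equiv.symm_apply_apply]
    rw [hsum]
    have e1 : (fun x y : ↥(boxDom (dbl fun i => n * M i)) =>
        torOpK n 0 (fun i => n * M i) ((boxDom (dbl fun i => n * L * M i)).image (blk L)) (e x) (e y)) =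
        torOpK n 0 (fun i => n * M i) (boxDom (dbl fun i => n * M i)) := by
      ext x y
      simp only [torOpK_apply, he, Equiv.coe_fn_mk, Subtype.ext_iff]
    rw [e1]
  · have hsum : ∀ (X : Matrix ↥((boxDom (dbl fun i => n * L * M i)).image (blk L))
        ↥((boxDom (dbl fun i => n * L * M i)).image (blk L)) ℝ),
        (fun y => φ (e.symm y)) ⬝ᵥ X *ᵥ (fun y => φ (e.symm y)) = φ ⬝ᵥ (fun x y => X (e x) (e y)) *ᵥ φ := by
      intro X
      simp only [dotProduct, mulVec]
      rw [← Fintype.sum_equiv e (fun x => φ (e.symm (e x)) * ∑ y, X (e x) y * φ (e.symm y)) _ (fun x => rfl)]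
      refine Finset.sum_congr rfl fun x _ => ?_
      rw [Equiv.symm_apply_apply]
      congr 1
      rw [← Fintype.sum_equiv e (fun y => X (e x) (e y) * φ (e.symm (e y))) _ (fun y => rfl)]
      exact Finset.sum_congr rfl fun y _ => by rw [Equiv.symm_apply_apply]
    rw [hsum]
    have e2 : (fun x y : ↥(boxDom (dbl fun i => n * M i)) =>
        torLine (isBlockUnion_fine (fineTor_isBlockUnion hn hL M)) n 0 (fun i => n * L * M i) (fun i => n * M i) s
          (e x) (e y)) = torLineRep (L := L) hn M s := by
      ext x y
      rfl
    rw [e2]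

/-- **ON REPRESENTATIVES: `n²(−Δ^𝕋) ⪯ T^𝕋(s)`** — `⟨φ, torOpK n 0 (n·M) φ⟩ ≤ ⟨φ, torLineRep s φ⟩` for `s ≥ 0`, every `φ` on
`boxDom (dbl (n·M))`. [folklore] -/
theorem torOpK_form_le_torLineRep (hn : 1 ≤ n) (hM : ∀ i, 1 ≤ M i) {s : ℝ} (hs0 : 0 ≤ s)
    (φ : ↥(boxDom (dbl fun i => n * M i)) → ℝ) :
    φ ⬝ᵥ torOpK n 0 (fun i => n * M i) (boxDom (dbl fun i => n * M i)) *ᵥ φ ≤ φ ⬝ᵥ torLineRep (L := L) hn M s *ᵥ φ := by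
  obtain ⟨V, h1, h2⟩ := forms_transport (L := L) hn s φ
  rw [h1, h2]
  exact torOpK_form_le_torLine (n := n) (L := L) (K := fun i => n * M i) (Nf := fun i => n * L * M i)
    (T := boxDom (dbl fun i => n * L * M i)) hn (mul_pos_side hn hM) (side_eq n L M) rfl
    (fineTor_isBlockUnion hn NeZero.one_le M) hs0 V

end Forms

/-! ### §2 The symbol floor: `σ_NN(p) ≤ σ_s(p)` -/

section Floor

variable {n : ℕ} {N : Fin (d + 1) → ℕ}

/-- the periodic operator at `a = 0` is translation-invariant entrywise. [folklore] -/
theorem torOpK_zero_transl_apply (n : ℕ) (hN : ∀ i, 1 ≤ N i) (v : Fin (d + 1) → ℤ) (x y : ↥(boxDom (dbl N))) :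
    torOpK n 0 N (boxDom (dbl N)) ⟨wrap (dbl N) (x.1 + v), wrap_mem_boxDom (dbl_pos hN) _⟩
        ⟨wrap (dbl N) (y.1 + v), wrap_mem_boxDom (dbl_pos hN) _⟩ = torOpK n 0 N (boxDom (dbl N)) x y := by
  have hP := dbl_pos hN
  rw [torOpK_apply, torOpK_apply]
  have e1 : ((⟨wrap (dbl N) (x.1 + v), wrap_mem_boxDom hP _⟩ : ↥(boxDom (dbl N))) =
      ⟨wrap (dbl N) (y.1 + v), wrap_mem_boxDom hP _⟩) ↔ x = y := by
    rw [Subtype.ext_iff, Subtype.ext_iff]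
    show wrap (dbl N) (x.1 + v) = wrap (dbl N) (y.1 + v) ↔ x.1 = y.1
    constructor
    · intro h
      have h2 := (wrap_add_eq_iff x.2 (wrap_mem_boxDom hP _)).1 h
      rw [sub_eq_add_neg, wrap_wrap_add, add_neg_cancel_right, wrap_eq_self y.2] at h2
      exact h2.symm
    · intro h; rw [h]
  have e2 : tadj N (wrap (dbl N) (x.1 + v)) (wrap (dbl N) (y.1 + v)) = tadj N x.1 y.1 := by
    rw [tadj_transl x.1 v (wrap_mem_boxDom hP _), sub_eq_add_neg, wrap_wrap_add, add_neg_cancel_right, wrap_eq_self y.2]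
  simp only [e1, e2, zero_mul, ite_self]

/-- the character at a unit vector: `χ_p(±e_μ) = exp(±2πi·p_μ∕P_μ)`. [folklore] -/
theorem chiT_uvec (P : Fin (d + 1) → ℕ) (p : Fin (d + 1) → ℤ) (μ : Fin (d + 1)) (ε : ℤ) :
    chiT P p (fun i => ε * uvec μ i) = Complex.exp ((((ε * p μ : ℤ) : ℝ) / (P μ : ℝ) : ℝ) * (2 * Real.pi * Complex.I)) := by
  unfold chiT
  congr 1
  rw [Finset.sum_eq_single μ]
  · simp only [uvec, Pi.single_eq_same, mul_one]
    push_cast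
    ring
  · intro ν _ hν
    simp [uvec, Pi.single_eq_of_ne hν]
  · intro h; exact absurd (Finset.mem_univ _) h

/-- **THE SYMBOL OF THE PERIODIC OPERATOR AT `a = 0`**: `symb(torOpK n 0 N)(p) = n²·Σ_μ (2 − χ_p(e_μ) − χ_p(−e_μ))`. [folklore] -/
theorem symbT_torOpK_zero (n : ℕ) (hN : ∀ i, 1 ≤ N i) (y₀ : ↥(boxDom (dbl N))) (p : Fin (d + 1) → ℤ) :
    symbT (dbl N) (torOpK n 0 N (boxDom (dbl N))) y₀ p =
      (n : ℂ) ^ 2 * ∑ μ : Fin (d + 1), (2 - chiT (dbl N) p (fun i => (1 : ℤ) * uvec μ i) -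
        chiT (dbl N) p (fun i => (-1 : ℤ) * uvec μ i)) := by
  classical
  have hP := dbl_pos hN
  -- the row, as complex numbers
  have hX : ∀ y : ↥(boxDom (dbl N)), (torOpK n 0 N (boxDom (dbl N)) y₀ y : ℂ) =
      (n : ℂ) ^ 2 * (if y₀ = y then 2 * ((d : ℂ) + 1) else 0) - (n : ℂ) ^ 2 * (tadj N y₀.1 y.1 : ℂ) := by
    intro y
    rw [torOpK_apply]
    split_ifs <;> push_cast <;> ring
  unfold symbT
  simp_rw [hX, sub_mul, Finset.sum_sub_distrib, mul_assoc, ← Finset.mul_sum]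
  -- the diagonal term
  have h1 : ∑ y : ↥(boxDom (dbl N)), (if y₀ = y then 2 * ((d : ℂ) + 1) else 0) * chiT (dbl N) p (y.1 - y₀.1) =
      2 * ((d : ℂ) + 1) := by
    rw [Finset.sum_eq_single y₀]
    · rw [if_pos rfl, sub_self]
      unfold chiT
      simp
    · intro y _ hy
      rw [if_neg (Ne.symm hy), zero_mul]
    · intro h; exact absurd (Finset.mem_univ _) h
  -- the neighbour term
  have key : ∀ z : Fin (d + 1) → ℤ, chiT (dbl N) p (wrap (dbl N) z - y₀.1) = chiT (dbl N) p (z - y₀.1) := by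
    intro z
    rw [sub_eq_add_neg, sub_eq_add_neg, chiT_add, chiT_add, chiT_wrap hP]
  have h2 : ∑ y : ↥(boxDom (dbl N)), (tadj N y₀.1 y.1 : ℂ) * chiT (dbl N) p (y.1 - y₀.1) =
      ∑ μ : Fin (d + 1), (chiT (dbl N) p (fun i => (1 : ℤ) * uvec μ i) + chiT (dbl N) p (fun i => (-1 : ℤ) * uvec μ i)) := by
    -- split into real and imaginary parts to use the real-valued neighbour sum
    have hre : (∑ y : ↥(boxDom (dbl N)), (tadj N y₀.1 y.1 : ℂ) * chiT (dbl N) p (y.1 - y₀.1)).re =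
        (∑ μ : Fin (d + 1), (chiT (dbl N) p (fun i => (1 : ℤ) * uvec μ i) +
          chiT (dbl N) p (fun i => (-1 : ℤ) * uvec μ i))).re := by
      rw [Complex.re_sum, Complex.re_sum]
      have e : ∀ y : ↥(boxDom (dbl N)), ((tadj N y₀.1 y.1 : ℂ) * chiT (dbl N) p (y.1 - y₀.1)).re =
          (tadj N y₀.1 y.1 : ℝ) * (chiT (dbl N) p (y.1 - y₀.1)).re := fun y => by simp
      simp_rw [e]
      rw [sum_tadj_mul hN y₀ (fun y => (chiT (dbl N) p (y.1 - y₀.1)).re), sum_nbrs]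
      refine Finset.sum_congr rfl fun μ _ => ?_
      simp only [key, add_sub_cancel_left, Complex.add_re]
      congr 2
      · congr 1; funext i; simp
      · congr 1; funext i; simp [sub_sub_cancel_left]
    have him : (∑ y : ↥(boxDom (dbl N)), (tadj N y₀.1 y.1 : ℂ) * chiT (dbl N) p (y.1 - y₀.1)).im =
        (∑ μ : Fin (d + 1), (chiT (dbl N) p (fun i => (1 : ℤ) * uvec μ i) +
          chiT (dbl N) p (fun i => (-1 : ℤ) * uvec μ i))).im := by
      rw [Complex.im_sum, Complex.im_sum]
      have e : ∀ y : ↥(boxDom (dbl N)), ((tadj N y₀.1 y.1 : ℂ) * chiT (dbl N) p (y.1 - y₀.1)).im =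
          (tadj N y₀.1 y.1 : ℝ) * (chiT (dbl N) p (y.1 - y₀.1)).im := fun y => by simp
      simp_rw [e]
      rw [sum_tadj_mul hN y₀ (fun y => (chiT (dbl N) p (y.1 - y₀.1)).im), sum_nbrs]
      refine Finset.sum_congr rfl fun μ _ => ?_
      simp only [key, add_sub_cancel_left, Complex.add_im]
      congr 2
      · congr 1; funext i; simp
      · congr 1; funext i; simp [sub_sub_cancel_left]
    exact Complex.ext hre him
  rw [h1, h2, Finset.sum_add_distrib]
  simp only [Finset.sum_const, Finset.card_univ, Fintype.card_fin, nsmul_eq_mul]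
  push_cast
  ring

/-- **`σ_NN(p)`: THE REAL SYMBOL OF THE PERIODIC OPERATOR** `= n²·Σ_μ (2 − 2cos(2π p_μ ∕ 2N_μ))`. [folklore] -/
theorem symbT_torOpK_zero_re (n : ℕ) (hN : ∀ i, 1 ≤ N i) (y₀ : ↥(boxDom (dbl N))) (p : Fin (d + 1) → ℤ) :
    (symbT (dbl N) (torOpK n 0 N (boxDom (dbl N))) y₀ p).re =
      (n : ℝ) ^ 2 * ∑ μ : Fin (d + 1), (2 - 2 * Real.cos (2 * Real.pi * p μ / (dbl N μ : ℝ))) := by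
  rw [symbT_torOpK_zero n hN y₀ p]
  have hcos : ∀ μ : Fin (d + 1), (2 - chiT (dbl N) p (fun i => (1 : ℤ) * uvec μ i) -
      chiT (dbl N) p (fun i => (-1 : ℤ) * uvec μ i)) = ((2 - 2 * Real.cos (2 * Real.pi * p μ / (dbl N μ : ℝ)) : ℝ) : ℂ) := by
    intro μ
    rw [chiT_uvec, chiT_uvec]
    have e1 : ((((1 : ℤ) * p μ : ℤ) : ℝ) / (dbl N μ : ℝ) : ℝ) * (2 * Real.pi * Complex.I) =
        ((2 * Real.pi * p μ / (dbl N μ : ℝ) : ℝ) : ℂ) * Complex.I := by push_cast; ring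
    have e2 : ((((-1 : ℤ) * p μ : ℤ) : ℝ) / (dbl N μ : ℝ) : ℝ) * (2 * Real.pi * Complex.I) =
        -(((2 * Real.pi * p μ / (dbl N μ : ℝ) : ℝ) : ℂ)) * Complex.I := by push_cast; ring
    rw [e1, e2]
    set θ : ℝ := 2 * Real.pi * p μ / (dbl N μ : ℝ) with hθ
    rw [show -((θ : ℝ) : ℂ) * Complex.I = ((-θ : ℝ) : ℂ) * Complex.I by push_cast; ring, Complex.exp_mul_I,
      Complex.exp_mul_I, ← Complex.ofReal_cos, ← Complex.ofReal_sin, ← Complex.ofReal_cos, ← Complex.ofReal_sin,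
      Real.cos_neg, Real.sin_neg]
    push_cast
    ring
  rw [Finset.sum_congr rfl (fun μ _ => hcos μ), ← Complex.ofReal_sum,
    show ((n : ℂ)) = ((n : ℝ) : ℂ) by norm_cast, ← Complex.ofReal_pow, ← Complex.ofReal_mul, Complex.ofReal_re]

variable {L : ℕ} [NeZero L] {M : Fin (d + 1) → ℕ}

/-- **B-E1 (c′), LOWER HALF OF THE WINDOW ON THE REAL TORUS: `σ_NN(p) ≤ σ_s(p)`** —
`n²·Σ_μ (2 − 2cos(2πp_μ∕2nM_μ)) ≤ Re σ_s(p)` (`= σ_s(p)`, file 38) for every `s ≥ 0`, mesh `n`, `L`, torus `M`, `p` (`a = 0`).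
[folklore] -/
theorem torSymb_re_ge_nn (hn : 1 ≤ n) (hM : ∀ i, 1 ≤ M i) {s : ℝ} (hs0 : 0 ≤ s)
    (y₀ : ↥(boxDom (dbl fun i => n * M i))) (p : Fin (d + 1) → ℤ) :
    (n : ℝ) ^ 2 * ∑ μ : Fin (d + 1), (2 - 2 * Real.cos (2 * Real.pi * p μ / (dbl (fun i => n * M i) μ : ℝ))) ≤
      (torSymb (L := L) hn M s y₀ p).re := by
  rw [← symbT_torOpK_zero_re n (mul_pos_side hn hM) y₀ p]
  exact symbT_re_le_torSymb_re hn hM s _ (torOpK_isSymm n 0 _ rfl)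
    (fun v x y => torOpK_zero_transl_apply n (mul_pos_side hn hM) v x y)
    (fun φ => torOpK_form_le_torLineRep hn hM hs0 φ) y₀ p

end Floor

end Summit.QuantumFields.BalabanUV.T4Continuum.NE7K1LinTorusFloor

end
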